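/- Copyright: ym3-torus cell, WIDTH-5 ATTACH seat `ym-ust-19936-w4` (prover, g11), for crux `HistoryTailL` (stmt-QuantumFields-19936),
line «local_insertion»: the organ-adjacent stub `stub_insertionHigher` is an ASYMPTOTIC-IN-HEIGHT statement only.
Released under the licence of the surrounding project. -/
import Summits.QuantumFields.YangMills.Theorems.LocalInsertionStubHeightOne
import HarnessLib

/-!
# Line «local_insertion» on crux `HistoryTailL` (stmt-QuantumFields-19936) — `stub_insertionHigher` ⟸ ITS OWN TAIL IN THE HEIGHT:
# bounded heights are free (✓`StubHeightOne.insertionIntegral_boundedHeight_le`), so a supplier of the organ may assume `j ≥ j₀(L)` as large as it likes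

Cell `ym3-torus` (YM ladder rung R3 = continuum SU(2) Yang–Mills on the three-torus — a RUNG, NOT the Clay problem: not d = 4, not
infinite volume, not a mass gap), width seat `ym-ust-19936-w4` gen 11, `--supports stmt-QuantumFields-19936 --as helper`.  THEOREMS ONLY,
definition-free, by-name layer.

WHAT.  After ✓`StubHeightOne.stub_insertionHeightOne` (height one, unconditional) line «local_insertion» reads `HistoryTailL ⟸ stub_insertionHigher`
(✓`StubHeightOne.historyTailL_of_insertionHigher`).  The organ-adjacent stub asks ONE `M₀` for ALL heights `2 ≤ j ≤ K`; but at every BOUNDED height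
the bound is a theorem with `(L, j₀, ε)`-constants (✓`StubHeightOne.insertionIntegral_boundedHeight_le`: crude transport × the level-0 uniform tail).
Hence (§1 ★★`insertionHigher_of_eventually`) the stub follows from its EVENTUAL version — the same text with `∃ j₀` after `L` and `j₀ ≤ j` in place of
`2 ≤ j` (`M₀ := max`, `γ₁ := min γ₁ (1∕8)`): BY KERNEL the organ of line #13 is a statement about LARGE heights only («averaging is smoothing» in the
regime `j → ∞` jointly with the co-height; LEAD census v1.19 (c) ∕ v1.22 (d)).  §2 ★★`localInsertionL_of_eventually` ∕ ★★`historyTailL_of_eventually`: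
the route crux `LocalInsertionL` (stmt-23607) and the target crux `HistoryTailL` from the eventual version alone.

HONEST FRAMING.  Doors (plumbing).  CONDITIONAL on the eventual organ text `hEv`, which is NOT in the tree and NOT in print for non-abelian d = 3
(it is K-uniform UV stability of one block observable at unbounded height).  Nothing of `stub_insertionHigher`, `LocalInsertionL`, `HistoryTailL`,
K1, NODE O, d = 4, a continuum limit or a mass gap is proved.  YM₃ on T³ is rung R3, NOT the Clay problem.

References: T. Bałaban, CMP **102** (1985) 255–275 [Balaban1985UV3] ((7) p.257, (71) p.273).
-/

set_option autoImplicit false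

noncomputable section

open scoped BigOperators
open MeasureTheory
open Literature.MathematicalPhysics.QuantumFieldTheory.Balaban1983to89
open Literature.MathematicalPhysics.QuantumFieldTheory.Balaban1983to89.T3ContinuumYM3Torus
open Literature.MathematicalPhysics.QuantumFieldTheory.Balaban1983to89.T3UnitScaleTilt
open Literature.MathematicalPhysics.QuantumFieldTheory.Balaban1983to89.T3UnitLawDensityEML
open Summit.QuantumFields.YangMills.Theorems.LocalInsertion.StubHeightOne
  (insertionIntegral_boundedHeight_le localInsertionL_of_insertionHigher historyTailL_of_insertionHigher)

namespace Summit.QuantumFields.YangMills.Theorems.LocalInsertion.HigherOfEventually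

/-! ## §1 The organ-adjacent stub from its eventual-in-height version -/

/-- **`stub_insertionHigher` ⟸ ITS EVENTUAL VERSION.**  If for every `L` there are a height floor `j₀` and `ε₀ > 0` such that the line's integrand
bound holds with ONE `M₀` for all heights `j₀ ≤ j ≤ K` (the hypothesis `hEv` — the stub's text with `∃ j₀` inserted and `j₀ ≤ j` for `2 ≤ j`), then the
registered text of `stub_insertionHigher` (`Cruxes/HistoryTailL/Lines/local_insertion.lean` 48f0ac19, VERBATIM conclusion) holds: heights `j < j₀` by
✓`insertionIntegral_boundedHeight_le (L) (j₀) (ε)` (`γ ≤ 1∕8`), heights `j ≥ j₀` by `hEv`; `M₀ := max`, `γ₁ := min`.  CONDITIONAL on `hEv` (organ).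
[cite: Balaban1985UV3, (7) p.257 and (71) p.273] -/
theorem insertionHigher_of_eventually
    (hEv : ∀ (L : ℕ), ∃ j₀ : ℕ, ∃ ε₀ : ℝ, 0 < ε₀ ∧ ∀ (ε : ℝ), 0 < ε → ε ≤ ε₀ → ∀ (b₀ p₀ : ℝ), 0 < b₀ → 2 < p₀ → ∃ M₀ : ℝ, 0 ≤ M₀ ∧ ∃ γ₁ : ℝ, 0 < γ₁ ∧ γ₁ ≤ 1 ∧ ∀ (F : T3Family) (γ : ℝ), F.L = L → 0 < γ → γ ≤ γ₁ → ∀ (K j : ℕ), j₀ ≤ j → j ≤ K → ∀ (a : Plaq (F.P K) j), ∫ U in {U : GaugeField (F.P K) 0 (Matrix.specialUnitaryGroup (Fin 2) ℂ) | (∀ (i : ℕ) (q : Plaq (F.P K) i), i < j → Site.tdist (fun k => ((((q.src k).val * F.L ^ i : ℕ)) : ZMod ((F.P K).sitesPerDir 0))) (fun k => ((((a.src k).val * F.L ^ j : ℕ)) : ZMod ((F.P K).sitesPerDir 0))) + 64 * F.L ^ i ≤ 64 * F.L ^ j → GaugeGroup.dist1 (GaugeField.plaqHol (Averaging.iter (fun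 i' => BlockAveraging.blockAvg (P := F.P K) (j := i') ℰp) i U) q) < θBal F.L γ b₀ p₀ (K - i))}, Real.exp (ε * min (GaugeGroup.dist1 (GaugeField.plaqHol (Averaging.iter (fun i' => BlockAveraging.blockAvg (P := F.P K) (j := i') ℰp) j U) a) / Real.sqrt (γ * ((F.L : ℝ)⁻¹) ^ (K - j))) (B10.pFun b₀ p₀ (Real.sqrt (γ * ((F.L : ℝ)⁻¹) ^ (K - j))))) ∂(gibbsK F ℰp γ K) ≤ M₀) :
    open Literature.MathematicalPhysics.QuantumFieldTheory.Balaban1983to89 Literature.MathematicalPhysics.QuantumFieldTheory.Balaban1983to89.T3ContinuumYM3Torus in ∀ (L : ℕ), ∃ ε₀ : ℝ, 0 < ε₀ ∧ ∀ (ε : ℝ), 0 < ε → ε ≤ ε₀ → ∀ (b₀ p₀ : ℝ), 0 < b₀ → 2 < p₀ → ∃ M₀ : ℝ, 0 ≤ M₀ ∧ ∃ γ₁ : ℝ, 0 < γ₁ ∧ γ₁ ≤ 1 ∧ ∀ (F : T3Family) (γ : ℝ), F.L = L → 0 < γ → γ ≤ γ₁ → ∀ (K j : ℕ), 1 ≤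 j → j ≤ K → 2 ≤ j → ∀ (a : Plaq (F.P K) j), ∫ U in {U | (∀ (i : ℕ) (q : Plaq (F.P K) i), i < j → Site.tdist (fun k => ((((q.src k).val * F.L ^ i : ℕ)) : ZMod ((F.P K).sitesPerDir 0))) (fun k => ((((a.src k).val * F.L ^ j : ℕ)) : ZMod ((F.P K).sitesPerDir 0))) + 64 * F.L ^ i ≤ 64 * F.L ^ j → GaugeGroup.dist1 (GaugeField.plaqHol (Averaging.iter (fun i' => BlockAveraging.blockAvg (P := F.P K) (j := i') T3UnitLawDensityEML.ℰp) i U) q) < T3UnitScaleTilt.θBal F.L γ b₀ p₀ (K - i))}, Real.exp (ε * min (GaugeGroup.dist1 (GaugeField.plaqHol (Averaging.iter (fun i' => BlockAveraging.blockAvg (P := F.P K) (j := i') T3UnitLawDensityEML.ℰp) j U) a) / Real.sqrt (γ * ((F.L : ℝ)⁻¹) ^ (K - j))) (B10.pFun b₀ p₀ (Real.sqrt (γ * ((F.L : ℝ)⁻¹) ^ (K - j))))) ∂(T3UnitScaleTilt.gibbsK F T3UnitLawDensityEML.ℰp γ K) ≤ M₀ := by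
  intro L
  obtain ⟨j₀, ε₀, hε₀, hL⟩ := hEv L
  refine ⟨ε₀, hε₀, fun ε hε hεle b₀ p₀ hb₀ hp₀ => ?_⟩
  obtain ⟨M₁, hM₁, γ₁, hγ₁, hγ₁1, H1⟩ := hL ε hε hεle b₀ p₀ hb₀ hp₀
  obtain ⟨M₂, hM₂, H2⟩ := insertionIntegral_boundedHeight_le L j₀ ε hε.le
  refine ⟨max M₁ M₂, le_max_of_le_left hM₁, min γ₁ (1 / 8), lt_min hγ₁ (by norm_num), (min_le_left _ _).trans hγ₁1,
    fun F γ hFL hγ hγle K j hj hjK _ a => ?_⟩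
  by_cases hj₀ : j₀ ≤ j
  · exact (H1 F γ hFL hγ (hγle.trans (min_le_left _ _)) K j hj₀ hjK a).trans (le_max_left _ _)
  · exact (H2 F γ hFL hγ (hγle.trans (min_le_right _ _)) b₀ p₀ K j hj hjK (by omega) a).trans (le_max_right _ _)

/-! ## §2 The route crux and the target crux from the eventual version -/

/-- **`LocalInsertionL` (stmt-QuantumFields-23607) ⟸ the eventual-in-height organ text alone.**  §1 ∘ ✓`StubHeightOne.localInsertionL_of_insertionHigher`.
CONDITIONAL on `hEv`. [cite: Balaban1985UV3, (71) p.273] -/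
theorem localInsertionL_of_eventually
    (hEv : ∀ (L : ℕ), ∃ j₀ : ℕ, ∃ ε₀ : ℝ, 0 < ε₀ ∧ ∀ (ε : ℝ), 0 < ε → ε ≤ ε₀ → ∀ (b₀ p₀ : ℝ), 0 < b₀ → 2 < p₀ → ∃ M₀ : ℝ, 0 ≤ M₀ ∧ ∃ γ₁ : ℝ, 0 < γ₁ ∧ γ₁ ≤ 1 ∧ ∀ (F : T3Family) (γ : ℝ), F.L = L → 0 < γ → γ ≤ γ₁ → ∀ (K j : ℕ), j₀ ≤ j → j ≤ K → ∀ (a : Plaq (F.P K) j), ∫ U in {U : GaugeField (F.P K) 0 (Matrix.specialUnitaryGroup (Fin 2) ℂ) | (∀ (i : ℕ) (q : Plaq (F.P K) i), i < j → Site.tdist (fun k => ((((q.src k).val * F.L ^ i : ℕ)) : ZMod ((F.P K).sitesPerDir 0))) (fun k => ((((a.src k).val * F.L ^ j : ℕ)) : ZMod ((F.P K).sitesPerDir 0))) + 64 * F.L ^ i ≤ 64 * F.L ^ j → GaugeGroup.dist1 (GaugeField.plaqHol (Averaging.iter (fun i' => BlockAveraging.blockAvg (P := F.P K) (j := i') ℰp)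 i U) q) < θBal F.L γ b₀ p₀ (K - i))}, Real.exp (ε * min (GaugeGroup.dist1 (GaugeField.plaqHol (Averaging.iter (fun i' => BlockAveraging.blockAvg (P := F.P K) (j := i') ℰp) j U) a) / Real.sqrt (γ * ((F.L : ℝ)⁻¹) ^ (K - j))) (B10.pFun b₀ p₀ (Real.sqrt (γ * ((F.L : ℝ)⁻¹) ^ (K - j))))) ∂(gibbsK F ℰp γ K) ≤ M₀) :
    Summit.QuantumFields.YangMills.Theses.LocalInsertion.LocalInsertionL :=
  localInsertionL_of_insertionHigher (insertionHigher_of_eventually hEv)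

/-- **`HistoryTailL` (stmt-QuantumFields-19936) ⟸ the eventual-in-height organ text alone**, through line «local_insertion» (§1 ∘
✓`StubHeightOne.historyTailL_of_insertionHigher` ∘ the landed glue 23608).  CONDITIONAL on `hEv`; nothing of `HistoryTailL` unconditionally, of d = 4
or a mass gap is proved; rung R3, NOT Clay. [cite: Balaban1985UV3, (71) p.273] -/
theorem historyTailL_of_eventually
    (hEv : ∀ (L : ℕ), ∃ j₀ : ℕ, ∃ ε₀ : ℝ, 0 < ε₀ ∧ ∀ (ε : ℝ), 0 < ε → ε ≤ ε₀ → ∀ (b₀ p₀ : ℝ), 0 < b₀ → 2 < p₀ → ∃ M₀ : ℝ, 0 ≤ M₀ ∧ ∃ γ₁ : ℝ, 0 < γ₁ ∧ γ₁ ≤ 1 ∧ ∀ (F : T3Family) (γ : ℝ), F.L = L → 0 < γ → γ ≤ γ₁ → ∀ (K j : ℕ), j₀ ≤ j → j ≤ K → ∀ (a : Plaq (F.P K) j), ∫ U in {U : GaugeField (F.P K) 0 (Matrix.specialUnitaryGroup (Fin 2) ℂ) | (∀ (i : ℕ) (q : Plaq (F.P K) i), i < j → Site.tdist (fun k => ((((q.src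 k).val * F.L ^ i : ℕ)) : ZMod ((F.P K).sitesPerDir 0))) (fun k => ((((a.src k).val * F.L ^ j : ℕ)) : ZMod ((F.P K).sitesPerDir 0))) + 64 * F.L ^ i ≤ 64 * F.L ^ j → GaugeGroup.dist1 (GaugeField.plaqHol (Averaging.iter (fun i' => BlockAveraging.blockAvg (P := F.P K) (j := i') ℰp) i U) q) < θBal F.L γ b₀ p₀ (K - i))}, Real.exp (ε * min (GaugeGroup.dist1 (GaugeField.plaqHol (Averaging.iter (fun i' => BlockAveraging.blockAvg (P := F.P K) (j := i') ℰp) j U) a) / Real.sqrt (γ * ((F.L : ℝ)⁻¹) ^ (K - j))) (B10.pFun b₀ p₀ (Real.sqrt (γ * ((F.L : ℝ)⁻¹) ^ (K - j))))) ∂(gibbsK F ℰp γ K) ≤ M₀) :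
    Summit.QuantumFields.YangMills.Theses.UnitScaleTilt.HistoryTailL :=
  historyTailL_of_insertionHigher (insertionHigher_of_eventually hEv)

end Summit.QuantumFields.YangMills.Theorems.LocalInsertion.HigherOfEventually

end
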